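import Summits.Ventures.Crystal3D.Theorems.StickyWulffConstantGenericWallFloorBarlowTopFamily
import Summits.Ventures.Crystal3D.Theorems.StickyWulffConstantGenericWallFloorWalkerFamilyLedger
import HarnessLib

/-!
# F4 core: the two walker families of a Barlow|Barlow wall cell are paid by the payers — `#T₁ + #T₂ ≤ Σ_PAY (12 − deg)`
# (crux `GenericWallFloor`, stmt-Ventures-19480, line `WallLedgerG`; lane T's F4, cf-p1 §86(58) BA / §86(66) BI)

HONEST FRAMING. Venture `Summits/Ventures/Crystal3D` (cell `crystal3d-full`), helper `--supports` the crux `GenericWallFloor`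
(stmt-Ventures-19480) of `route-Ventures-StickyWulffConstant`, registered line `WallLedgerG`, open stub `stub_twoSlabAdhesion`.
Rung credit only; F-C1 not moved; NOT the stub.  Inputs BY NAME: E1 (`ExactOnly`), `DoubleStarCoaxialAt`, `CapPairCoaxial`
(both from `StarPairFar`), and the OFF-REGISTRY hypotheses (the two reach sets miss the other plate's stacking and each other).

`bottomFamily_spec` (`…BarlowBottomFamily`) and `topFamily_spec` (`…BarlowTopFamily`) deliver, for the two window families of the
cell of `BilayerWallAt`, every hypothesis of `walkerFamilies_card_le_payers` (`…WalkerFamilyLedger`, p637489); positional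
disjointness of the ends comes from the two reach sets being disjoint.  Hence

* **`barlowFamilies_card_le_payers`** — `(#T₁ : ℝ) + #T₂ ≤ Σ_{y ∈ PAY} (12 − deg y)`,
  `PAY = {y ∈ X : deg y ≠ 12, −R₀−2 ≤ y₂ ≤ h+R₀+2}`.
What remains for lane T's covered wall stub: the rim lines (`card_le_of_injOn_annulus`), the identification of `T₁/T₂` with the
line sets of `cell_charge_le_lines_sel` (selector = machine steps, `isZigSelector_machineStep`; orientation by word reversal), and
`bilayerWallAt_of_payerBound`.
WHAT THIS IS NOT: not the stub; F-C1 not moved.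
-/

noncomputable section

namespace Summit.Ventures.Crystal3D.Theorems

open Finset
open Literature.MathematicalPhysics.StatisticalMechanics
open Summit.Ventures.Crystal3D.Cruxes.TextureLiminf.TexShadow (stacking)
open scoped InnerProductSpace

variable {X : Finset (EuclideanSpace ℝ (Fin 3))}

open scoped Classical in
/-- **The two Barlow walker families are paid by the payers.**  Hypotheses: the cell of `BilayerWallAt` (`R₀ ≥ 6`), E1 and the
star facts, for EACH plate the walk data of `…BarlowPrefix` (bottom: vertical `e₃`, frame `L₁`; top: vertical `−e₃`, frame `L₂`, each
presented with its layer index increasing along its vertical), steep family slots, steps rising `≥ δ`, the off-registry hypotheses,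
and the two window families with their bands / lateral radii / fuel as in `bottomFamily_spec` / `topFamily_spec`. -/
theorem barlowFamilies_card_le_payers (hX : ∀ p ∈ X, ∀ q ∈ X, p ≠ q → 1 ≤ dist p q)
    {sE : EuclideanSpace ℝ (Fin 3)} (hsE : sE ∈ fccSlots) (hcert : ExactOnly 0 (fccSlots.filter fun w => 0 < ⟪w, sE⟫_ℝ))
    (hDS : ∀ F₁ F₂ : EuclideanSpace ℝ (Fin 3) ≃ₗᵢ[ℝ] EuclideanSpace ℝ (Fin 3), DoubleStarCoaxialAt F₁ F₂) (hCP : CapPairCoaxial)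
    -- the cell
    {σ₁ σ₂ : ℤ → ℤ} (hσ₁ : IsHaggSeq σ₁) (hσ₂ : IsHaggSeq σ₂)
    (L₁ L₂ : EuclideanSpace ℝ (Fin 3) ≃ₗᵢ[ℝ] EuclideanSpace ℝ (Fin 3)) (s₀ s₂ : EuclideanSpace ℝ (Fin 3))
    (R₀ h ρ : ℝ) (hR₀ : 6 ≤ R₀) (hh : 0 ≤ h) (hρ : 1 ≤ ρ) (P₁ P₂ : Finset (EuclideanSpace ℝ (Fin 3))) (hP₁X : P₁ ⊆ X) (hP₂X : P₂ ⊆ X)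
    (hcell : ∀ p ∈ X, -(2 * R₀) ≤ p 2 ∧ p 2 ≤ h + 2 * R₀ ∧ p 0 ^ 2 + p 1 ^ 2 ≤ ρ ^ 2)
    (hP₁ : ∀ p, p ∈ P₁ ↔ (p ∈ stacking L₁ s₀ σ₁ ∧ -(2 * R₀) ≤ p 2 ∧ p 2 ≤ -R₀ ∧ p 0 ^ 2 + p 1 ^ 2 ≤ ρ ^ 2))
    (hP₂ : ∀ p, p ∈ P₂ ↔ (p ∈ stacking L₂ s₂ σ₂ ∧ h + R₀ ≤ p 2 ∧ p 2 ≤ h + 2 * R₀ ∧ p 0 ^ 2 + p 1 ^ 2 ≤ ρ ^ 2))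
    -- bottom walk data (vertical e₃)
    (v₁ : EuclideanSpace ℝ (Fin 3)) (canon₁ : ℤ → EuclideanSpace ℝ (Fin 3) → EuclideanSpace ℝ (Fin 3) × List WalkEntry)
    (ms₁ : ℤ → EuclideanSpace ℝ (Fin 3))
    (hv₁ : v₁ ∈ fccSlots) (hv₁2 : v₁ 2 = Real.sqrt (2 / 3))
    (hsteep₁ : Real.sqrt 2 / 2 ≤ ⟪L₁ v₁, EuclideanSpace.single (2 : Fin 3) (1 : ℝ)⟫_ℝ)
    (hcanon₁₁ : ∀ m t, σ₁ (m - 1) = 1 → canon₁ m t = (t, [⟨L₁, v₁, 0⟩]))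
    (hcanon₁₂ : ∀ m t, σ₁ (m - 1) = -1 → canon₁ m t =
      (t, [⟨twinFrame L₁ (L₁ (EuclideanSpace.single (2 : Fin 3) (1 : ℝ))),
            bestCapper (twinFrame L₁ (L₁ (EuclideanSpace.single (2 : Fin 3) (1 : ℝ)))) (L₁ (EuclideanSpace.single (2 : Fin 3) (1 : ℝ)))
              (EuclideanSpace.single (2 : Fin 3) (1 : ℝ)),
            L₁ (EuclideanSpace.single (2 : Fin 3) (1 : ℝ))⟩, ⟨L₁, v₁, 0⟩]))
    (hms₁₁ : ∀ m, σ₁ m = 1 → ms₁ m = v₁)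
    (hms₁₂ : ∀ m, σ₁ m = -1 → ms₁ m =
      basalMirror (bestCapper (twinFrame L₁ (L₁ (EuclideanSpace.single (2 : Fin 3) (1 : ℝ)))) (L₁ (EuclideanSpace.single (2 : Fin 3) (1 : ℝ)))
        (EuclideanSpace.single (2 : Fin 3) (1 : ℝ))))
    {δ₁ : ℝ} (hδ₁0 : 0 < δ₁) (hδ₁ : ∀ m, δ₁ ≤ ⟪L₁ (ms₁ m), EuclideanSpace.single (2 : Fin 3) (1 : ℝ)⟫_ℝ)
    -- top walk data (vertical −e₃)
    (v₂ : EuclideanSpace ℝ (Fin 3)) (canon₂ : ℤ → EuclideanSpace ℝ (Fin 3) → EuclideanSpace ℝ (Fin 3) × List WalkEntry)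
    (ms₂ : ℤ → EuclideanSpace ℝ (Fin 3))
    (hv₂ : v₂ ∈ fccSlots) (hv₂2 : v₂ 2 = Real.sqrt (2 / 3))
    (hsteep₂ : Real.sqrt 2 / 2 ≤ ⟪L₂ v₂, -EuclideanSpace.single (2 : Fin 3) (1 : ℝ)⟫_ℝ)
    (hcanon₂₁ : ∀ m t, σ₂ (m - 1) = 1 → canon₂ m t = (t, [⟨L₂, v₂, 0⟩]))
    (hcanon₂₂ : ∀ m t, σ₂ (m - 1) = -1 → canon₂ m t =
      (t, [⟨twinFrame L₂ (L₂ (EuclideanSpace.single (2 : Fin 3) (1 : ℝ))),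
            bestCapper (twinFrame L₂ (L₂ (EuclideanSpace.single (2 : Fin 3) (1 : ℝ)))) (L₂ (EuclideanSpace.single (2 : Fin 3) (1 : ℝ)))
              (-EuclideanSpace.single (2 : Fin 3) (1 : ℝ)),
            L₂ (EuclideanSpace.single (2 : Fin 3) (1 : ℝ))⟩, ⟨L₂, v₂, 0⟩]))
    (hms₂₁ : ∀ m, σ₂ m = 1 → ms₂ m = v₂)
    (hms₂₂ : ∀ m, σ₂ m = -1 → ms₂ m =
      basalMirror (bestCapper (twinFrame L₂ (L₂ (EuclideanSpace.single (2 : Fin 3) (1 : ℝ)))) (L₂ (EuclideanSpace.single (2 : Fin 3) (1 : ℝ)))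
        (-EuclideanSpace.single (2 : Fin 3) (1 : ℝ))))
    {δ₂ : ℝ} (hδ₂0 : 0 < δ₂) (hδ₂ : ∀ m, δ₂ ≤ ⟪L₂ (ms₂ m), -EuclideanSpace.single (2 : Fin 3) (1 : ℝ)⟫_ℝ)
    -- off-registry
    (hoff₁ : ∀ y ∈ reachSet L₁ (L₁ ((haggLabel σ₁ 0 : ℝ) • barlowOffset 1) + s₀) (chainFrames (EuclideanSpace.single (2 : Fin 3) (1 : ℝ)) L₁ v₁),
      y ∉ stacking L₂ s₂ σ₂)
    (hoff₂ : ∀ y ∈ reachSet L₂ (L₂ ((haggLabel σ₂ 0 : ℝ) • barlowOffset 1) + s₂) (chainFrames (-EuclideanSpace.single (2 : Fin 3) (1 : ℝ)) L₂ v₂),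
      y ∉ stacking L₁ s₀ σ₁)
    (hdisjR : ∀ y ∈ reachSet L₁ (L₁ ((haggLabel σ₁ 0 : ℝ) • barlowOffset 1) + s₀) (chainFrames (EuclideanSpace.single (2 : Fin 3) (1 : ℝ)) L₁ v₁),
      y ∉ reachSet L₂ (L₂ ((haggLabel σ₂ 0 : ℝ) • barlowOffset 1) + s₂) (chainFrames (-EuclideanSpace.single (2 : Fin 3) (1 : ℝ)) L₂ v₂))
    -- the two window families
    (H₁ H₂ ρin : ℝ) (hH₁lo : -(2 * R₀) + 2 ≤ H₁) (hH₁hi : H₁ ≤ -R₀ - 3) (hH₂lo : -(h + 2 * R₀) + 2 ≤ H₂) (hH₂hi : H₂ ≤ -(h + R₀) - 3)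
    (hρin₁ : ρin + 8 / 3 * (h + 4 * R₀) + ((-R₀ - 2 - H₁) / δ₁ + 2) ≤ ρ - 1)
    (hρin₂ : ρin + 8 / 3 * (h + 4 * R₀) + ((-(h + R₀) - 2 - H₂) / δ₂ + 2) ≤ ρ - 1)
    {ι₁ ι₂ : Type*} (T₁ : Finset ι₁) (T₂ : Finset ι₂) (m₁ a₁ b₁ : ι₁ → ℤ) (m₂ a₂ b₂ : ι₂ → ℤ)
    (hlow₁ : ∀ i ∈ T₁, H₁ ≤ ⟪L₁ (barlowPos 1 (Real.sqrt (2 / 3)) σ₁ (m₁ i) (a₁ i) (b₁ i)) + s₀, EuclideanSpace.single (2 : Fin 3) (1 : ℝ)⟫_ℝ)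
    (hpred₁ : ∀ i ∈ T₁, ⟪L₁ (barlowPos 1 (Real.sqrt (2 / 3)) σ₁ (m₁ i) (a₁ i) (b₁ i) - ms₁ (m₁ i - 1)) + s₀,
      EuclideanSpace.single (2 : Fin 3) (1 : ℝ)⟫_ℝ < H₁)
    (hinjT₁ : ∀ i ∈ T₁, ∀ j ∈ T₁,
      barlowPos 1 (Real.sqrt (2 / 3)) σ₁ (m₁ i) (a₁ i) (b₁ i) = barlowPos 1 (Real.sqrt (2 / 3)) σ₁ (m₁ j) (a₁ j) (b₁ j) → i = j)
    (hlat₁ : ∀ i ∈ T₁, Real.sqrt ((L₁ (barlowPos 1 (Real.sqrt (2 / 3)) σ₁ (m₁ i) (a₁ i) (b₁ i)) + s₀) 0 ^ 2 +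
      (L₁ (barlowPos 1 (Real.sqrt (2 / 3)) σ₁ (m₁ i) (a₁ i) (b₁ i)) + s₀) 1 ^ 2) ≤ ρin)
    (hlow₂ : ∀ i ∈ T₂, H₂ ≤ ⟪L₂ (barlowPos 1 (Real.sqrt (2 / 3)) σ₂ (m₂ i) (a₂ i) (b₂ i)) + s₂, -EuclideanSpace.single (2 : Fin 3) (1 : ℝ)⟫_ℝ)
    (hpred₂ : ∀ i ∈ T₂, ⟪L₂ (barlowPos 1 (Real.sqrt (2 / 3)) σ₂ (m₂ i) (a₂ i) (b₂ i) - ms₂ (m₂ i - 1)) + s₂,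
      -EuclideanSpace.single (2 : Fin 3) (1 : ℝ)⟫_ℝ < H₂)
    (hinjT₂ : ∀ i ∈ T₂, ∀ j ∈ T₂,
      barlowPos 1 (Real.sqrt (2 / 3)) σ₂ (m₂ i) (a₂ i) (b₂ i) = barlowPos 1 (Real.sqrt (2 / 3)) σ₂ (m₂ j) (a₂ j) (b₂ j) → i = j)
    (hlat₂ : ∀ i ∈ T₂, Real.sqrt ((L₂ (barlowPos 1 (Real.sqrt (2 / 3)) σ₂ (m₂ i) (a₂ i) (b₂ i)) + s₂) 0 ^ 2 +
      (L₂ (barlowPos 1 (Real.sqrt (2 / 3)) σ₂ (m₂ i) (a₂ i) (b₂ i)) + s₂) 1 ^ 2) ≤ ρin)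
    -- fuel
    {N : ℕ} (hN₁ : ⌈(-R₀ - 2 - H₁) / δ₁⌉₊ + 1 ≤ N) (hN₂ : ⌈(-(h + R₀) - 2 - H₂) / δ₂⌉₊ + 1 ≤ N) (hN : 8 * (h + 4 * R₀) < 3 * (N : ℝ)) :
    (T₁.card : ℝ) + T₂.card ≤
      ∑ y ∈ X.filter (fun y => (X.filter fun q => dist y q = 1).card ≠ 12 ∧ -R₀ - 2 ≤ y 2 ∧ y 2 ≤ h + R₀ + 2),
        ((12 : ℝ) - ((X.filter fun q => dist y q = 1).card : ℝ)) := by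
  set e₃ : EuclideanSpace ℝ (Fin 3) := EuclideanSpace.single (2 : Fin 3) (1 : ℝ) with he₃
  have he₃n : ‖e₃‖ = 1 := by rw [he₃, PiLp.norm_single, norm_one]
  have hztn : ‖-e₃‖ = 1 := by rw [norm_neg, he₃n]
  have he₃i : ∀ d : EuclideanSpace ℝ (Fin 3), ⟪d, e₃⟫_ℝ = d 2 := fun d => by rw [he₃, EuclideanSpace.inner_single_right]; simp
  obtain ⟨hB, hinjB⟩ := bottomFamily_spec σ₁ L₁ s₀ v₁ canon₁ ms₁ hσ₁ hX hsE hcert hσ₂ L₂ s₂ R₀ h ρ hR₀ hh hρ P₁ P₂ hP₁X hP₂X hcell hP₁ hP₂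
    hv₁ hv₁2 hsteep₁ hcanon₁₁ hcanon₁₂ hms₁₁ hms₁₂ hδ₁0 hδ₁ hoff₁ H₁ ρin hH₁lo hH₁hi hρin₁ T₁ m₁ a₁ b₁ hlow₁ hpred₁ hinjT₁ hlat₁ hN₁ hN
  obtain ⟨hT, hinjT⟩ := topFamily_spec σ₂ L₂ s₂ v₂ canon₂ ms₂ hσ₂ hX hsE hcert hσ₁ L₁ s₀ R₀ h ρ hR₀ hh hρ P₁ P₂ hP₁X hP₂X hcell hP₁ hP₂
    hv₂ hv₂2 hsteep₂ hcanon₂₁ hcanon₂₂ hms₂₁ hms₂₂ hδ₂0 hδ₂ hoff₂ H₂ ρin hH₂lo hH₂hi hρin₂ T₂ m₂ a₂ b₂ hlow₂ hpred₂ hinjT₂ hlat₂ hN₂ hN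
  set st₁ : ι₁ → EuclideanSpace ℝ (Fin 3) × List WalkEntry :=
    fun i => canon₁ (m₁ i) (L₁ (barlowPos 1 (Real.sqrt (2 / 3)) σ₁ (m₁ i) (a₁ i) (b₁ i)) + s₀) with hst₁
  set st₂ : ι₂ → EuclideanSpace ℝ (Fin 3) × List WalkEntry :=
    fun i => canon₂ (m₂ i) (L₂ (barlowPos 1 (Real.sqrt (2 / 3)) σ₂ (m₂ i) (a₂ i) (b₂ i)) + s₂) with hst₂
  have hH₁ : ∀ q ∈ X, ⟪q, e₃⟫_ℝ ≤ h + 2 * R₀ := fun q hq => by rw [he₃i]; exact (hcell q hq).2.1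
  have hH₂ : ∀ q ∈ X, ⟪q, -e₃⟫_ℝ ≤ 2 * R₀ := fun q hq => by rw [inner_neg_right, he₃i]; linarith [(hcell q hq).1]
  refine walkerFamilies_card_le_payers hX hsE hcert hDS hCP he₃n hztn hH₁ hH₂ T₁ T₂ st₁ st₂ (b₁ := ⟨L₁, v₁, 0⟩) (b₂ := ⟨L₂, v₂, 0⟩) N
    (fun t ht => ?_) (fun t ht => ?_) hinjB hinjT _ (fun t ht => (hB t ht).2.2.2.2.2.1) (fun t ht => (hT t ht).2.2.2.2.2.1)
    (fun t ht t' ht' heq => ?_)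
  · obtain ⟨hI, hW, hl, hC, hf, -, -⟩ := hB t ht
    exact ⟨hI, hW, hl, hC, hf⟩
  · obtain ⟨hI, hW, hl, hC, hf, -, -⟩ := hT t ht
    exact ⟨hI, hW, hl, hC, hf⟩
  · exact hdisjR _ (hB t ht).2.2.2.2.2.2 (heq ▸ (hT t' ht').2.2.2.2.2.2)

end Summit.Ventures.Crystal3D.Theorems

end
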